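import Summits.HodgeConjecture.HodgeConjecture.Theses.So7OddThetaNulls
import Literature.AlgebraicGeometry.HodgeTheory.GysinFormalism
import Literature.AlgebraicTopology.SingularHomology.CupProduct
import HarnessLib

/-!
# Birth skeleton for crux `CayleyCarrier` (route `So7OddThetaNulls`, item stmt-HodgeConjecture-18789)

Line `birth` (skeleton registrar, 2026-08-17). The crux: granted the oddness of the 24 `so(7)`
theta-nulls (`OddThetaNulls`), every abelian eightfold `A` of the datum (quaternion multiplication
`e₁, e₂`, `e₁² = e₂² = -N²`, `e₁e₂ = -e₂e₁`; an irreducible polarised K3-type `T ⊂ H²(A, ℚ)` of rank 7 with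
Gram `U ⊕ U ⊕ ⟨2⟩³`) carries two `ℂ`-independent rational algebraic `(2,2)`-classes (an algebraic class in
`B²(A)` off the line `ℚθ²`: van Geemen–Verra's open question, §6).

## The line (sketch run/shared/lean/mwave/sketch/HodgeConjecture/so7-odd-thetanull-cayley, K2a/K2b/(I))

The natural output of the theta construction is NOT a codimension-2 cycle but a codimension-4 one: the
odd theta-nulls single out a rank-10 quadric relation on a 10-dimensional theta system (the `(8,10)`
van Geemen map `f : A ⇢ Q⁸ ⊂ ℙ⁹`, one Clifford level above the `(4,6)` theta fourfolds of van Geemen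
1996), and the two rulings `Λ± ≅ ℙ⁴` of the smooth 8-dimensional quadric pull back to codimension-4
cycles; `δ := [f^*Λ₊] - [f^*Λ₋] ∈ H⁸(A)`. The crux then splits into three genuinely different pieces:

* `stub_carrier` (XL, the engine; the ONLY stub that consumes `OddThetaNulls`): an algebraic rational
  `δ ∈ H⁸(A(ℂ); ℂ)` which is `Charged` — its intersection number with a Cayley twist
  `(g^* - Nrd(g)²)c` and `θ²` is non-zero (one rational number; sketch K2a + K2b, certificate (I)).
* `stub_lowering` (L; Lieberman 1968 / Kleiman 1968, `B(A)` for abelian varieties — the tree's named fact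
  `Literature.AlgebraicGeometry.HodgeTheory.Lieberman1968_lefschetzInvolution_algebraic_abelianVariety`,
  NOT yet proved on the carriers; alternatively Beauville–Künnemann: `Λ` is the Pontryagin product with
  `θ⁷/7!` — plus hard Lefschetz, PROVED: `nonempty_hardLefschetzNFold_holds`): a charged algebraic
  rational `δ ∈ H⁸` lowers to an algebraic rational `y := (L_h⁴)⁻¹(δ ∪ θ²) ∈ H⁴` which is `LowCharged`
  (`⟨y ∪ x ∪ h⁴⟩ = ⟨δ ∪ θ² ∪ x⟩ ≠ 0`, `h` the hyperplane class).
* `stub_separation` (M/L; Rosati/degree bookkeeping for the quaternion action + hard Lefschetz, all inputs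
  proved in the tree: `map_mem_algebraicClasses_of_abelianVariety`, `IsRationalClass.pullback`,
  `abelianVarietyCohomologyExteriorH1_holds`, `cupProduct_gradedComm_holds`, `nonempty_hardLefschetzNFold_holds`):
  a `LowCharged` algebraic rational `y ∈ H⁴` and `θ²` are two independent rational algebraic classes
  (if the rational algebraic divisor classes have `ℚ`-rank `≥ 2`, `h ∪ h`, `h ∪ θ'` already do; if they are
  `ℚθ₀`, then `g^*θ₀ = Nrd(g)θ₀` and `θ₀⁶ ∪ (g^* - Nrd(g)²)c = 0`, so `y ∉ ℂθ₀²`).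

`CayleyCarrier_of_stubs : stub_carrier-sig → stub_lowering-sig → stub_separation-sig → CayleyCarrier` is
proved below (pure logic, no `sorry`), and `CayleyCarrier_of : CayleyCarrier := CayleyCarrier_of_stubs
stub_carrier stub_lowering stub_separation` concludes the crux BY NAME from the stubs BY NAME. `stub_lowering` and `stub_separation` quantify over the quaternionic eightfold only (they do not
use `T`); `stub_carrier` carries the full datum of the crux verbatim.

## Disproof used

None: `Cruxes/CayleyCarrier/` had no `Disproof.lean` and `ledger negatives --problem HodgeConjecture` has no
entry on theta-nulls / so(7) / eightfolds at registration time. The line uses the route hypothesis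
`OddThetaNulls` at `stub_carrier` only.

## BC3 (registrar folder `bc/`, farm `lean check --json`, 2026-08-17)

* This file: rc 0, `errors = []`, `sorries = 3` = the three `stub_*` (no `sorry` elsewhere);
  `#print axioms CayleyCarrier_of_stubs` = `[propext, Classical.choice, Quot.sound]`.
* Probes `stub → CayleyCarrier` and `stub → _root_.HodgeConjecture` (defs copied verbatim, no stub in
  scope): `stub_carrier` — 8/8 batteries fail (`bc/carrier_probe2.lean`, rc 1: `exact?` "could not close
  the goal" ×2, `simpa using h` / `unfold …; simpa using h` "Type mismatch after simplification" ×4,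
  `aesop` "failed to prove the goal after exhaustive search" ×2; the combined `first | …` form only hit
  whnf heartbeat time-outs, hence the split batteries); `stub_lowering` — 2/2 fail
  (`bc/lowering_probe.lean`, rc 1: `first | exact? | simpa | (intro h; unfold …; simpa using h) | aesop`
  ends in `unsolved goals` + aesop exhaustive-search failure for both targets); `stub_separation` — 2/2
  fail (`bc/separation_probe.lean`, rc 1, same verdicts). No stub is cheaply the crux or the summit.
-/

-- `Summit.<Summit>.<Problem>`: for the single-conjunct summit the duplicate `HodgeConjecture.HodgeConjecture`
-- is mandated by the layout (D-0017); silence the linter as the sibling crux workfiles do.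
set_option linter.dupNamespace false

noncomputable section

namespace Summit.HodgeConjecture.HodgeConjecture.Cruxes.CayleyCarrier.Birth

open CategoryTheory

/-! ### The quaternion order and the Cayley twist -/

/-- The endomorphism `a + b·e₁ + b'·e₂ + d·(e₁ ≫ e₂)` of the order `ℤ⟨e₁, e₂⟩ ⊂ End A` generated by
the quaternion multiplication of the datum (`e₁² = e₂² = -N²`, `e₁e₂ = -e₂e₁`; van Geemen–Verra §6.1:
`End⁰(A) = D` a definite quaternion algebra for an eightfold of `so(7)`-type).
[cite: vanGeemenVerra2003QuaternionicPryms, §6.1–6.2] -/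
def quatEnd (A : Literature.AlgebraicGeometry.Motives.AbelianVariety ℂ) (e₁ e₂ : A ⟶ A) (a b b' d : ℤ) : A ⟶ A :=
  a • CategoryTheory.CategoryStruct.id A + b • e₁ + b' • e₂ + d • CategoryTheory.CategoryStruct.comp e₁ e₂

/-- The reduced norm `Nrd(a + b·e₁ + b'·e₂ + d·e₁e₂) = a² + N²(b² + b'²) + N⁴d²` of `quatEnd`
(`1, e₁, e₂, e₁e₂` are orthogonal for the norm form, of norms `1, N², N², N⁴`). On `H¹(A, ℚ)`, a free
module of rank `4` over the division algebra `(-N², -N²)_ℚ ≅ (-1, -1)_ℚ`, `g^*` has determinant `Nrd(g)⁸`;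
`g^*` multiplies a polarisation class `θ` whose Rosati involution induces the canonical involution by
`Nrd(g)` (Mumford, Abelian Varieties §21, type III). [cite: vanGeemenVerra2003QuaternionicPryms, §6.1] -/
def quatNorm (N : ℕ) (a b b' d : ℤ) : ℤ :=
  a ^ 2 + (N : ℤ) ^ 2 * (b ^ 2 + b' ^ 2) + (N : ℤ) ^ 4 * d ^ 2

/-- The **Cayley twist** of a degree-4 class by `g = quatEnd A e₁ e₂ a b b' d`:
`g^* c - Nrd(g)² · c ∈ H⁴(A(ℂ); ℂ)`. On the Hodge classes `B²(A) = ℚθ² ⊕ P` of an `so(7)`-type eightfold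
(van Geemen–Verra Prop. 6.5 / 6.7: `P ⊗ ℂ` the irreducible 5-dimensional representation of
`(End A ⊗ ℂ)ˣ ≅ GL₂(ℂ)`, the "Cayley classes") the twists kill the line `ℚθ²` (`g^*θ = Nrd(g)·θ`) and,
as `g` and `c` vary, span `P`: pairing non-trivially with a Cayley twist is the route's typed
substitute for "has a non-zero Cayley component".
[cite: vanGeemenVerra2003QuaternionicPryms, Prop. 6.5, 6.7, Lemma 6.8] -/
def cayleyTwist (A : Literature.AlgebraicGeometry.Motives.AbelianVariety ℂ) (N : ℕ) (e₁ e₂ : A ⟶ A) (a b b' d : ℤ)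
    (c : Literature.AlgebraicGeometry.HodgeTheory.complexBetti A.X (2 * 2)) : Literature.AlgebraicGeometry.HodgeTheory.complexBetti A.X (2 * 2) :=
  Literature.AlgebraicGeometry.HodgeTheory.complexBetti.map (quatEnd A e₁ e₂ a b b' d).hom.hom.hom (2 * 2) c -
    ((quatNorm N a b b' d : ℂ) ^ 2) • c

/-- A degree-8 class `δ ∈ H⁸(A(ℂ); ℂ)` is **charged** if the intersection number
`δ ∪ (g^*c - Nrd(g)²c) ∪ θ ∪ θ ∈ H¹⁶(A(ℂ); ℂ)` is non-zero for some rational divisor class `θ`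
(rational, in `N¹H²`), some rational class `c ∈ H⁴` and some `g` in the quaternion order. For an
algebraic `δ` on an `so(7)`-type eightfold this says exactly that the `L⁴P`-component of `δ ∪ θ²` in
`B⁶(A) = ℚθ⁶ ⊕ L⁴P` is non-zero, i.e. that `δ` carries Cayley charge visible after two Lefschetz
lowerings (sketch (I): `Λ²δ ∉ ℚθ²`); it is ONE rational intersection number, computable at the type-III
cusp of the family. [cite: vanGeemenVerra2003QuaternionicPryms, Lemma 6.8, Thm. 6.9] -/
def Charged (A : Literature.AlgebraicGeometry.Motives.AbelianVariety ℂ) (N : ℕ) (e₁ e₂ : A ⟶ A)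
    (δ : Literature.AlgebraicGeometry.HodgeTheory.complexBetti A.X (2 * 4)) : Prop :=
  ∃ (θ : Literature.AlgebraicGeometry.HodgeTheory.complexBetti A.X (2 * 1)) (c : Literature.AlgebraicGeometry.HodgeTheory.complexBetti A.X (2 * 2)) (a b b' d : ℤ),
    Literature.AlgebraicGeometry.HodgeTheory.IsRationalClass θ ∧ θ ∈ Literature.AlgebraicGeometry.HodgeTheory.algebraicClasses A.X 1 ∧ Literature.AlgebraicGeometry.HodgeTheory.IsRationalClass c ∧
    Literature.AlgebraicTopology.SingularHomology.cupProduct (show 2 * 4 + 2 * 4 = 2 * 8 by norm_num) δ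
      (Literature.AlgebraicTopology.SingularHomology.cupProduct (show 2 * 2 + 2 * 2 = 2 * 4 by norm_num) (cayleyTwist A N e₁ e₂ a b b' d c)
        (Literature.AlgebraicTopology.SingularHomology.cupProduct (show 2 * 1 + 2 * 1 = 2 * 2 by norm_num) θ θ)) ≠ 0

/-- A degree-4 class `y ∈ H⁴(A(ℂ); ℂ)` is **charged in low degree** if
`y ∪ (g^*c - Nrd(g)²c) ∪ θ⁴ ≠ 0` in `H¹⁶(A(ℂ); ℂ)` for some rational divisor class `θ ∈ N¹H²`, rational
`c ∈ H⁴` and `g` in the quaternion order — the degree-4 shadow of `Charged` under `(L_θ⁴)⁻¹ ∘ L_θ²`: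
such a `y` cannot lie on the line `ℂθ²` because `θ⁶ ∪ (g^* - Nrd(g)²)c = 0` in top degree
(`g^*θ = Nrd(g)θ`, `deg g = Nrd(g)⁸`). [cite: vanGeemenVerra2003QuaternionicPryms, Lemma 6.8] -/
def LowCharged (A : Literature.AlgebraicGeometry.Motives.AbelianVariety ℂ) (N : ℕ) (e₁ e₂ : A ⟶ A)
    (y : Literature.AlgebraicGeometry.HodgeTheory.complexBetti A.X (2 * 2)) : Prop :=
  ∃ (θ : Literature.AlgebraicGeometry.HodgeTheory.complexBetti A.X (2 * 1)) (c : Literature.AlgebraicGeometry.HodgeTheory.complexBetti A.X (2 * 2)) (a b b' d : ℤ),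
    Literature.AlgebraicGeometry.HodgeTheory.IsRationalClass θ ∧ θ ∈ Literature.AlgebraicGeometry.HodgeTheory.algebraicClasses A.X 1 ∧ Literature.AlgebraicGeometry.HodgeTheory.IsRationalClass c ∧
    Literature.AlgebraicTopology.SingularHomology.cupProduct (show 2 * 2 + 2 * 6 = 2 * 8 by norm_num) y
      (Literature.AlgebraicTopology.SingularHomology.cupProduct (show 2 * 2 + 2 * 4 = 2 * 6 by norm_num) (cayleyTwist A N e₁ e₂ a b b' d c)
        (Literature.AlgebraicTopology.SingularHomology.cupProduct (show 2 * 2 + 2 * 2 = 2 * 4 by norm_num)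
          (Literature.AlgebraicTopology.SingularHomology.cupProduct (show 2 * 1 + 2 * 1 = 2 * 2 by norm_num) θ θ)
          (Literature.AlgebraicTopology.SingularHomology.cupProduct (show 2 * 1 + 2 * 1 = 2 * 2 by norm_num) θ θ))) ≠ 0

/-! ### The three stubs -/

/-- **stub_carrier** (XL — the engine of the route; sketch K2a + K2b). Granted `OddThetaNulls`, every
eightfold of the datum carries an ALGEBRAIC RATIONAL CHARGED class `δ ∈ H⁸(A(ℂ); ℂ)`.
Intended witness: on the isogenous model carrying the level-2 thetas, the 24 odd theta-nulls cut out a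
10-dimensional theta system `W` with a rank-10 quadric relation holding exactly on the `so(7)` locus
(Riemann's quadratic relation makes `κ(A)` lie on the 24 quadrics `Q_ab`, (Q)(ii) of the sketch); the
dominant rational map `f : A ⇢ Q⁸ ⊂ ℙ⁹` pulls the two rulings `Λ± ≅ ℙ⁴` back to codimension-4 cycles
and `δ := [f^*Λ₊] - [f^*Λ₋]` (transported through the isogeny; fallback carriers (m1)–(m4) of the
sketch). The charge is ONE intersection number `⟨δ ∪ (g^*c - Nrd(g)²c) ∪ θ²⟩ ≠ 0`, computable at the
type-III cusp (sketch (I), S3). Why plausible: it is van Geemen's `(4,6)` quadric-ruling mechanism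
(Math. Z. 221 (1996); LNM 1594, 7.4–7.5) run one Clifford level up, on the only level-2 theta structure
that is `so(7)`-specific (rigidity no-go (R) of the sketch). Why it might fail: the ruling pull-back may
be Lefschetz (`δ ∪ θ² ∈ ℚθ⁶`), or the 10-dimensional piece may not exist on any isogenous model.
Leans on: `Literature.NumberTheory.ModularForms.So7KugaSatake.thetaCoeff/chars/flipQ` (landed),
`Literature.AlgebraicGeometry.HodgeTheory.algebraicClasses`, `IsRationalClass`; missing carriers (theta embeddings `A → ℙⁿ`, quadrics and
their rulings as cycles) are the prover's to posit as support. Size XL.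
[cite: vanGeemen1996ThetaFourfolds] [cite: vanGeemenVerra2003QuaternionicPryms, §6, Lemma 6.8, Thm. 6.9]
[cite: vanGeemen2000KugaSatakeHC] -/
theorem stub_carrier :
    Summit.HodgeConjecture.HodgeConjecture.Theses.So7OddThetaNulls.OddThetaNulls → ∀ (A : Literature.AlgebraicGeometry.Motives.AbelianVariety ℂ) (N : ℕ) (e₁ e₂ : A ⟶ A), 0 < N → A.dim = 8 → Literature.AlgebraicGeometry.Motives.IsSmoothProjective 8 A.X → CategoryTheory.CategoryStruct.comp e₁ e₁ = -((N ^ 2) • CategoryTheory.CategoryStruct.id A) → CategoryTheory.CategoryStruct.comp e₂ e₂ = -((N ^ 2) • CategoryTheory.CategoryStruct.id A) → CategoryTheory.CategoryStruct.comp e₁ e₂ = -(CategoryTheory.CategoryStruct.comp e₂ e₁) → ∀ (T : Type) [AddCommGroup T] [Module ℚ T] (H : Literature.AlgebraicGeometry.Motives.HodgeStructure T 2) (P : H.Polarization) (j : T →ₗ[ℚ] Literature.AlgebraicTopology.SingularHomology.singularCohomology ℚ ℚ (Literature.AlgebraicGeometry.Motives.ComplexPoints A.X) 2), H.F 3 =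 ⊥ → H.hodgeNumber 2 0 = 1 → H.hodgeClasses 1 = ⊥ → (∃ b : Module.Basis (Fin 7) ℚ T, ∀ i k : Fin 7, P.form (b i) (b k) = (!![0, 1, 0, 0, 0, 0, 0; 1, 0, 0, 0, 0, 0, 0; 0, 0, 0, 1, 0, 0, 0; 0, 0, 1, 0, 0, 0, 0; 0, 0, 0, 0, 2, 0, 0; 0, 0, 0, 0, 0, 2, 0; 0, 0, 0, 0, 0, 0, 2] : Matrix (Fin 7) (Fin 7) ℚ) i k) → Function.Injective j → (∀ (p q : ℤ) (p' q' : ℕ), (p' : ℤ) = p → (q' : ℤ) = q → ∀ x ∈ H.piece p q, Literature.AlgebraicGeometry.HodgeTheory.IsOfHodgeType 8 A.X 2 p' q' (Literature.AlgebraicGeometry.Motives.ofRatClassBaseChange (Literature.AlgebraicGeometry.Motives.ComplexPoints A.X) 2 (j.baseChange ℂ x))) → ∃ δ : Literature.AlgebraicGeometry.HodgeTheory.complexBetti A.X (2 * 4), δ ∈ Literature.AlgebraicGeometry.HodgeTheory.algebraicClasses A.X 4 ∧ Literature.AlgebraicGeometry.HodgeTheory.IsRationalClass δ ∧ Summit.HodgeConjecture.HodgeConjecture.Cruxes.CayleyCarrier.Birth.Charged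 A N e₁ e₂ δ := by
  sorry

/-- **stub_lowering** (L — Lieberman lowering). On a quaternionic abelian eightfold, a charged algebraic
rational `δ ∈ H⁸(A(ℂ); ℂ)` yields an algebraic rational `y ∈ H⁴(A(ℂ); ℂ)` which is `LowCharged`.
Intended proof: let `h` be the hyperplane class of `nonempty_hardLefschetzNFold_holds 8 A.X` (rational,
in `N¹H²`, hard Lefschetz: `L_h⁴ : H⁴ ≅ H¹²`); `δ ∪ θ²` is algebraic (`AbelianVariety.cupProduct_mem_algebraicClasses_one`
twice) and rational; put `y := (L_h⁴)⁻¹(δ ∪ θ²)`: rational by `HardLefschetzNFold.isRationalClass_L_iff`,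
ALGEBRAIC by Lieberman's theorem `B(A)` (the inverse Lefschetz isomorphism is an algebraic
correspondence on an abelian variety — named fact
`Literature.AlgebraicGeometry.HodgeTheory.Lieberman1968_lefschetzInvolution_algebraic_abelianVariety`, to be discharged on the carriers, e.g. via
Beauville–Künnemann: `Λ_θ =` Pontryagin product with `θ⁷/7!`), and
`⟨y ∪ x ∪ h⁴⟩ = ⟨L_h⁴ y ∪ x⟩ = ⟨δ ∪ θ² ∪ x⟩ ≠ 0` (`cupProduct_assoc`, `cupProduct_gradedComm_holds`), so
`y` is `LowCharged` with witnesses `(h, c, g)`. Why it might fail as typed: only through a library gap —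
`B(A)` is a theorem in print. Size L (the `B(A)` discharge dominates).
[cite: Lieberman1968, main theorem] [cite: Kleiman1968AlgebraicCycles, Thm. 2A11]
[cite: VoisinHodgeI2002, Thm. 6.25] -/
theorem stub_lowering :
    ∀ (A : Literature.AlgebraicGeometry.Motives.AbelianVariety ℂ) (N : ℕ) (e₁ e₂ : A ⟶ A), 0 < N → A.dim = 8 → Literature.AlgebraicGeometry.Motives.IsSmoothProjective 8 A.X → CategoryTheory.CategoryStruct.comp e₁ e₁ = -((N ^ 2) • CategoryTheory.CategoryStruct.id A) → CategoryTheory.CategoryStruct.comp e₂ e₂ = -((N ^ 2) • CategoryTheory.CategoryStruct.id A) → CategoryTheory.CategoryStruct.comp e₁ e₂ = -(CategoryTheory.CategoryStruct.comp e₂ e₁) → ∀ δ : Literature.AlgebraicGeometry.HodgeTheory.complexBetti A.X (2 * 4), δ ∈ Literature.AlgebraicGeometry.HodgeTheory.algebraicClasses A.X 4 → Literature.AlgebraicGeometry.HodgeTheory.IsRationalClass δ → Summit.HodgeConjecture.HodgeConjecture.Cruxes.CayleyCarrier.Birth.Charged A N e₁ e₂ δ → ∃ y : Literature.AlgebraicGeometry.HodgeTheory.complexBetti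 A.X (2 * 2), y ∈ Literature.AlgebraicGeometry.HodgeTheory.algebraicClasses A.X 2 ∧ Literature.AlgebraicGeometry.HodgeTheory.IsRationalClass y ∧ Summit.HodgeConjecture.HodgeConjecture.Cruxes.CayleyCarrier.Birth.LowCharged A N e₁ e₂ y := by
  sorry

/-- **stub_separation** (M/L — the quaternion action separates a low-charged class from `θ²`). On a
quaternionic abelian eightfold, a `LowCharged` algebraic rational `y ∈ H⁴(A(ℂ); ℂ)` gives two
`ℂ`-independent rational algebraic degree-4 classes. Intended proof: let `R ⊂ H²` be the `ℚ`-space of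
rational classes in `N¹H²` and `h ∈ R` the hyperplane class (`nonempty_hardLefschetzNFold_holds`).
(i) If `R` has two `ℚ`-independent elements `h, θ'`, then `h ∪ h`, `h ∪ θ'` are rational, algebraic
(`HardLefschetzNFold.lefschetzOperator_mem_algebraicClasses`) and independent (`L_h` is injective on `H²`
since `L_h⁶ : H² ≅ H¹⁴`; `linearIndependent_iff_of_isRationalClass`). (ii) If `R ⊆ ℚθ₀`: the witness
divisor class of `LowCharged` is `rθ₀`, `r ≠ 0`; `g^*` preserves `R`
(`map_mem_algebraicClasses_of_abelianVariety`, `IsRationalClass.pullback`), so `g^*θ₀ = λ(g)θ₀` with `λ`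
multiplicative, quadratic in `g`, and `λ(g)⁸ θ₀⁸ = g^*θ₀⁸ = Nrd(g)⁸θ₀⁸` (`H¹⁶ = ⋀¹⁶H¹`,
`abelianVarietyCohomologyExteriorH1_holds`; `H¹` is free of rank 4 over the division algebra
`ℚ⟨e₁, e₂⟩`, so `det g^*|_(H¹) = Nrd(g)⁸`), whence `λ = Nrd` and
`θ₀⁶ ∪ (g^*c - Nrd(g)²c) = Nrd(g)⁻²·(g^* - Nrd(g)⁸)(θ₀⁶ ∪ c) = 0`; so `⟨θ₀² ∪ x ∪ θ₀⁴⟩ = 0 ≠ ⟨y ∪ x ∪ θ₀⁴⟩`,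
`y ∉ ℂθ₀²`, and `y, θ₀²` (`θ₀² ≠ 0` by hard Lefschetz, algebraic, rational) are the two classes. Why it
might fail as typed: only if some quaternionic eightfold had `g^*` acting on rational divisor classes
other than by `Nrd` while `ρ = 1` — excluded by the degree count above. Size M/L.
[cite: vanGeemenVerra2003QuaternionicPryms, Lemma 6.8] [cite: VoisinHodgeI2002, Thm. 6.25 and §7.1.2] -/
theorem stub_separation :
    ∀ (A : Literature.AlgebraicGeometry.Motives.AbelianVariety ℂ) (N : ℕ) (e₁ e₂ : A ⟶ A), 0 < N → A.dim = 8 → Literature.AlgebraicGeometry.Motives.IsSmoothProjective 8 A.X → CategoryTheory.CategoryStruct.comp e₁ e₁ = -((N ^ 2) • CategoryTheory.CategoryStruct.id A) → CategoryTheory.CategoryStruct.comp e₂ e₂ = -((N ^ 2) • CategoryTheory.CategoryStruct.id A) → CategoryTheory.CategoryStruct.comp e₁ e₂ = -(CategoryTheory.CategoryStruct.comp e₂ e₁) → ∀ y : Literature.AlgebraicGeometry.HodgeTheory.complexBetti A.X (2 * 2), y ∈ Literature.AlgebraicGeometry.HodgeTheory.algebraicClasses A.X 2 → Literature.AlgebraicGeometry.HodgeTheory.IsRationalClass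 y → Summit.HodgeConjecture.HodgeConjecture.Cruxes.CayleyCarrier.Birth.LowCharged A N e₁ e₂ y → ∃ c₁ c₂ : Literature.AlgebraicGeometry.HodgeTheory.complexBetti A.X (2 * 2), c₁ ∈ Literature.AlgebraicGeometry.HodgeTheory.algebraicClasses A.X 2 ∧ c₂ ∈ Literature.AlgebraicGeometry.HodgeTheory.algebraicClasses A.X 2 ∧ Literature.AlgebraicGeometry.HodgeTheory.IsRationalClass c₁ ∧ Literature.AlgebraicGeometry.HodgeTheory.IsRationalClass c₂ ∧ LinearIndependent ℂ ![c₁, c₂] := by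
  sorry

/-! ### The composition (kernel-checked, no sorry) -/

/-- **Sorry-free assembly**: `stub_carrier-sig → stub_lowering-sig → stub_separation-sig → CayleyCarrier`
(pure logic: instantiate the carrier at the datum, lower it, separate it). The conclusion is LITERALLY the
route decl `Summit.HodgeConjecture.HodgeConjecture.Theses.So7OddThetaNulls.CayleyCarrier`. [folklore] -/
theorem CayleyCarrier_of_stubs :
    (Summit.HodgeConjecture.HodgeConjecture.Theses.So7OddThetaNulls.OddThetaNulls → ∀ (A : Literature.AlgebraicGeometry.Motives.AbelianVariety ℂ) (N : ℕ) (e₁ e₂ : A ⟶ A), 0 < N → A.dim = 8 → Literature.AlgebraicGeometry.Motives.IsSmoothProjective 8 A.X → CategoryTheory.CategoryStruct.comp e₁ e₁ = -((N ^ 2) • CategoryTheory.CategoryStruct.id A) → CategoryTheory.CategoryStruct.comp e₂ e₂ = -((N ^ 2) • CategoryTheory.CategoryStruct.id A) → CategoryTheory.CategoryStruct.comp e₁ e₂ = -(CategoryTheory.CategoryStruct.comp e₂ e₁) → ∀ (T : Type) [AddCommGroup T] [Module ℚ T] (H : Literature.AlgebraicGeometry.Motives.HodgeStructure T 2) (P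 : H.Polarization) (j : T →ₗ[ℚ] Literature.AlgebraicTopology.SingularHomology.singularCohomology ℚ ℚ (Literature.AlgebraicGeometry.Motives.ComplexPoints A.X) 2), H.F 3 = ⊥ → H.hodgeNumber 2 0 = 1 → H.hodgeClasses 1 = ⊥ → (∃ b : Module.Basis (Fin 7) ℚ T, ∀ i k : Fin 7, P.form (b i) (b k) = (!![0, 1, 0, 0, 0, 0, 0; 1, 0, 0, 0, 0, 0, 0; 0, 0, 0, 1, 0, 0, 0; 0, 0, 1, 0, 0, 0, 0; 0, 0, 0, 0, 2, 0, 0; 0, 0, 0, 0, 0, 2, 0; 0, 0, 0, 0, 0, 0, 2] : Matrix (Fin 7) (Fin 7) ℚ) i k) → Function.Injective j → (∀ (p q : ℤ) (p' q' : ℕ), (p' : ℤ) = p → (q' : ℤ) = q → ∀ x ∈ H.piece p q, Literature.AlgebraicGeometry.HodgeTheory.IsOfHodgeType 8 A.X 2 p' q' (Literature.AlgebraicGeometry.Motives.ofRatClassBaseChange (Literature.AlgebraicGeometry.Motives.ComplexPoints A.X) 2 (j.baseChange ℂ x))) → ∃ δ : Literature.AlgebraicGeometry.HodgeTheory.complexBetti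 A.X (2 * 4), δ ∈ Literature.AlgebraicGeometry.HodgeTheory.algebraicClasses A.X 4 ∧ Literature.AlgebraicGeometry.HodgeTheory.IsRationalClass δ ∧ Summit.HodgeConjecture.HodgeConjecture.Cruxes.CayleyCarrier.Birth.Charged A N e₁ e₂ δ) →
    (∀ (A : Literature.AlgebraicGeometry.Motives.AbelianVariety ℂ) (N : ℕ) (e₁ e₂ : A ⟶ A), 0 < N → A.dim = 8 → Literature.AlgebraicGeometry.Motives.IsSmoothProjective 8 A.X → CategoryTheory.CategoryStruct.comp e₁ e₁ = -((N ^ 2) • CategoryTheory.CategoryStruct.id A) → CategoryTheory.CategoryStruct.comp e₂ e₂ = -((N ^ 2) • CategoryTheory.CategoryStruct.id A) → CategoryTheory.CategoryStruct.comp e₁ e₂ = -(CategoryTheory.CategoryStruct.comp e₂ e₁) → ∀ δ : Literature.AlgebraicGeometry.HodgeTheory.complexBetti A.X (2 * 4), δ ∈ Literature.AlgebraicGeometry.HodgeTheory.algebraicClasses A.X 4 → Literature.AlgebraicGeometry.HodgeTheory.IsRationalClass δ → Summit.HodgeConjecture.HodgeConjecture.Cruxes.CayleyCarrier.Birth.Charged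 A N e₁ e₂ δ → ∃ y : Literature.AlgebraicGeometry.HodgeTheory.complexBetti A.X (2 * 2), y ∈ Literature.AlgebraicGeometry.HodgeTheory.algebraicClasses A.X 2 ∧ Literature.AlgebraicGeometry.HodgeTheory.IsRationalClass y ∧ Summit.HodgeConjecture.HodgeConjecture.Cruxes.CayleyCarrier.Birth.LowCharged A N e₁ e₂ y) →
    (∀ (A : Literature.AlgebraicGeometry.Motives.AbelianVariety ℂ) (N : ℕ) (e₁ e₂ : A ⟶ A), 0 < N → A.dim = 8 → Literature.AlgebraicGeometry.Motives.IsSmoothProjective 8 A.X → CategoryTheory.CategoryStruct.comp e₁ e₁ = -((N ^ 2) • CategoryTheory.CategoryStruct.id A) → CategoryTheory.CategoryStruct.comp e₂ e₂ = -((N ^ 2) • CategoryTheory.CategoryStruct.id A) → CategoryTheory.CategoryStruct.comp e₁ e₂ = -(CategoryTheory.CategoryStruct.comp e₂ e₁) → ∀ y : Literature.AlgebraicGeometry.HodgeTheory.complexBetti A.X (2 * 2), y ∈ Literature.AlgebraicGeometry.HodgeTheory.algebraicClasses A.X 2 → Literature.AlgebraicGeometry.HodgeTheory.IsRationalClass y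 → Summit.HodgeConjecture.HodgeConjecture.Cruxes.CayleyCarrier.Birth.LowCharged A N e₁ e₂ y → ∃ c₁ c₂ : Literature.AlgebraicGeometry.HodgeTheory.complexBetti A.X (2 * 2), c₁ ∈ Literature.AlgebraicGeometry.HodgeTheory.algebraicClasses A.X 2 ∧ c₂ ∈ Literature.AlgebraicGeometry.HodgeTheory.algebraicClasses A.X 2 ∧ Literature.AlgebraicGeometry.HodgeTheory.IsRationalClass c₁ ∧ Literature.AlgebraicGeometry.HodgeTheory.IsRationalClass c₂ ∧ LinearIndependent ℂ ![c₁, c₂]) →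
    Summit.HodgeConjecture.HodgeConjecture.Theses.So7OddThetaNulls.CayleyCarrier := by
  intro hC hL hS hOdd A N e₁ e₂ hN hdim hsp he₁ he₂ he₁₂ T _ _ H P j hF hh hT hb hj hc
  obtain ⟨δ, hδa, hδr, hδc⟩ :=
    hC hOdd A N e₁ e₂ hN hdim hsp he₁ he₂ he₁₂ T H P j hF hh hT hb hj hc
  obtain ⟨y, hya, hyr, hyc⟩ := hL A N e₁ e₂ hN hdim hsp he₁ he₂ he₁₂ δ hδa hδr hδc
  exact hS A N e₁ e₂ hN hdim hsp he₁ he₂ he₁₂ y hya hyr hyc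

/-- **THE SKELETON THEOREM (registrar shape).** The crux
`Summit.HodgeConjecture.HodgeConjecture.Theses.So7OddThetaNulls.CayleyCarrier`, concluded BY NAME from the three
declared stubs (by name) through the sorry-free assembly `CayleyCarrier_of_stubs`; the only `sorry`s in
its closure are `stub_carrier`, `stub_lowering`, `stub_separation`. -/
theorem CayleyCarrier_of :
    Summit.HodgeConjecture.HodgeConjecture.Theses.So7OddThetaNulls.CayleyCarrier :=
  CayleyCarrier_of_stubs stub_carrier stub_lowering stub_separation

end Summit.HodgeConjecture.HodgeConjecture.Cruxes.CayleyCarrier.Birth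

end
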